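import Literature.Geometry.Kaehler.ComplexTorusSubtorusClassPullbackPoint
import Literature.Geometry.Kaehler.ComplexTorusSemipositiveTensorH0
import Literature.Geometry.Kaehler.ComplexTorusAnalyticCycleClassSubtorus
import Literature.Geometry.Kaehler.ComplexTorusPointCycleClass
import HarnessLib

/-!
# The subtorus frame of a complex lattice subspace, and `cl(Y) = p^*[pt_{X/Y}]` with complex orientations

Layer `Literature/Geometry/Kaehler`, namespace `Literature.Geometry.Kaehler.ComplexTorus`; lane `lit-hodgefound`
(Track 2 foundations library), prover seat `lit-hodgefound-p36` (gen 8, row #5), sequel of row #4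
(`ComplexTorusSubtorusClassPullbackPoint`: `[Y] = sign_Y(λ′) · p^*vol_{X/Y}` for the adapted frame `λ′` of `Λ ∩ W`).
The lane presents complex subtori of `X = E/Φ(ℤ^ι)` in two vocabularies: by a complex lattice subspace
`W ⊆ Λ ⊗ ℝ` (rows A1-19 / Q247: `IsLatticeSubspace`, `IsComplexSubspace`, `subtorusPeriod`, `quotientTorusPeriod`,
`p^* = inflateForms`) and by a saturated, positively oriented lattice frame (row A4-18: `SubtorusFrame`, its cycle
class `[Z] = (Φu) ⌟ vol` and its ANALYTIC cycle class through the current of integration,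
`ComplexTorusAnalyticCycleClassSubtorus`). This file builds the bridge `SubtorusFrame.ofSubspace` and reads row #4
in the frame vocabulary: the (analytic) class of `Y = π(ΦW) = p⁻¹(0)` is the pull-back of the point class of
`X/Y` — Fulton's flat pull-back `f^*[V] = [f⁻¹(V)]` for the projection `p : X → X/Y` and `V = {0}`, with
`cl ∘ f^* = f^* ∘ cl`, now with the complex orientations of `Y`, `X`, `X/Y` throughout (Voisin (2002), Cor. 11.15).

Sources, verbatim. W. Fulton, *Intersection Theory* [held `book:fultonnd-intersection-theory`], §1.7 (p0029
L11–L22): "Let `f : X → Y` be a flat morphism of relative dimension `n` […] `f^*[V] = [f⁻¹(V)]`"; Cor. 19.2 (b)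
(p0365 L34): "`cl` commutes with `f^*`". Lange–Birkenhake (1992), Exercise 1.1.6 (2)(a) (a complex subtorus =
a subgroup `Λ′ ⊂ Λ` of rank `2g′` with `Λ′ ⊗ ℝ` a complex subspace). C. Voisin (2002), §11.1.2 Cor. 11.15
(orientations of `Z ⊂ X`).

## Contents (one definition with body — `SubtorusFrame.ofSubspace` — and theorems; NO named fact)

§1 `span_range_intVec_adapted_reindex`, **`span_range_latticeTuple_adapted_reindex`** (`Σ ℝ Φλ′ᵢ = Φ(W)`),
**`frameSpan_adapted_reindex_eq_cxSpan`** (`Σ ℂ Φλ′ᵢ = cxSpan Φ W`), for any re-enumeration `eY` of `λ′`.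

§2 `even_of_equiv_subRank`, **`torusIntegral_wedge_pullback_volumeForm_reindex`**
(`∫_X η ∧ p^*vol_{X/Y} = sign_Y(eY) · η(Φ(λ′∘eY))`, row A2's Fubini),
**`cycleFormOfFrame_adapted_reindex_eq_orientationSign_smul`** (`[Z_{λ′∘eY}] = sign_Y(eY) · p^*vol_{X/Y}`) and
`cycleFormOfFrame_adapted_reindex_eq_pullback_volumeForm` (`= p^*vol_{X/Y}` when `sign_Y(eY) = 1`).

§3 `finiteDimensional_cxSpan`, **`exists_orientationSign_subtorusPeriod_eq_one`** (a positively oriented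
enumeration of `λ′` exists — a transposition fixes a negative one; `rk = 0` is vacuously positive),
`exists_orientationSign_subtorusPeriod_eq_one_two_mul` (indexed by `Fin (2d)`); the definition
**`SubtorusFrame.ofSubspace Φ W hW hWc eY hpos : SubtorusFrame Φ m`** (frame `λ′ ∘ eY`; saturated; positively
oriented), `ofSubspace_frame`, **`realSpan_ofSubspace`** (`= Φ(W)`), **`carrier_ofSubspace_zero`** (`= π(W)`),
`carrier_ofSubspace_zero_eq_range` (`= range ι_Y`), **`carrier_ofSubspace_zero_eq_ker`** (`= p⁻¹(0)`), and
**`cycleForm_ofSubspace`**: `[Z] = p^*vol_{X/Y}`.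

§4 (inner-product model space, as in row A4-18 stage (ii)) **`analyticCycleClass_ofSubspace_carrier`**:
`cl(Y) = sign(e) · p^*vol_{X/Y}` for the analytic cycle class of `Y`, and
**`analyticCycleClass_ofSubspace_carrier_of_orientationSign_eq_one`**: `cl(Y) = p^*[pt_{X/Y}]` on the nose for a
positively oriented enumeration `e` of the lattice basis of `X`.

## References

* [Fulton1998] W. Fulton, *Intersection Theory*, 2nd ed., Springer (1998), §1.7, §19.2 Cor. 19.2 (b).
* [LangeBirkenhake1992] H. Lange, Ch. Birkenhake, *Complex Abelian Varieties*, Springer (1992), Exercise 1.1.6 (2)(a).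
* [Lange2023AbelianVarietiesComplex] H. Lange, *Abelian Varieties over the Complex Numbers*, Springer (2023),
  §1.1.6 Exercise (2)(a) (p. 26), §1.4.1 Prop. 1.4.2 (proof, p. 43), §1.5.4 (p. 58), §2.2.1 Lemma 2.2.4 (proof),
  §2.5.3 Lemma 2.5.14, §6.2.4 (p. 310).
* [VoisinHodgeI2002] C. Voisin, *Hodge Theory and Complex Algebraic Geometry I*, CUP (2002), §11.1.2 Cor. 11.15.
* [WarnerGTM94] F. W. Warner, *Foundations of Differentiable Manifolds and Lie Groups*, GTM 94 (1983), Exercise 2.13.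
-/

noncomputable section

-- Nested instance problems on the carriers `↥(rationalForms Φ k)` (cf. `ComplexTorusSubtorusRestrictionKernel`).
set_option maxSynthPendingDepth 3

open Module Function

namespace Literature.Geometry.Kaehler

namespace ComplexTorus

/-! ### §1. The adapted frame spans `Φ(W)`; its complex span is `cxSpan Φ W` -/

section Spans

variable {ι : Type*} [Fintype ι] {E : Type*} [NormedAddCommGroup E] [NormedSpace ℂ E]
  (Φ : (ι → ℝ) ≃L[ℝ] E) (W : Submodule ℝ (ι → ℝ)) (hW : IsLatticeSubspace W) {m : ℕ}

include hW in
/-- The columns of `C = subtorusMatrix W` (the adapted frame `λ′`, re-enumerated by `eY`) span `W` over `ℝ`.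
[cite: Lange2023AbelianVarietiesComplex, §1.1.6 Exercise (2)(a) (p. 26)] -/
theorem span_range_intVec_adapted_reindex (eY : Fin m ≃ Fin (subRank W)) :
    Submodule.span ℝ (Set.range fun i ↦ intVec (adaptedBasis W (adaptedEmb W (eY i)))) = W := by
  have hcol : (Set.range fun i ↦ intVec (adaptedBasis W (adaptedEmb W (eY i)))) =
      Set.range ((subtorusMatrix W).map (Int.cast : ℤ → ℝ)).col := by
    ext x
    simp only [Set.mem_range]
    constructor
    · rintro ⟨i, rfl⟩; exact ⟨eY i, rfl⟩
    · rintro ⟨j, rfl⟩; exact ⟨eY.symm j, by rw [Equiv.apply_symm_apply]; rfl⟩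
  rw [hcol, ← Matrix.range_mulVecLin, range_subtorusMatrix_mulVecLin hW]

include hW in
/-- **The adapted frame spans `Φ(W)`**: `Σ ℝ Φλ′ᵢ = Φ(W)`. [cite: Lange2023AbelianVarietiesComplex, §1.1.6 Exercise (2)(a) (p. 26)] -/
theorem span_range_latticeTuple_adapted_reindex (eY : Fin m ≃ Fin (subRank W)) :
    Submodule.span ℝ (Set.range (latticeTuple Φ fun i ↦ adaptedBasis W (adaptedEmb W (eY i)))) =
      W.map (Φ : (ι → ℝ) →ₗ[ℝ] E) := by
  have h : Set.range (latticeTuple Φ fun i ↦ adaptedBasis W (adaptedEmb W (eY i))) =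
      (Φ : (ι → ℝ) →ₗ[ℝ] E) '' Set.range (fun i ↦ intVec (adaptedBasis W (adaptedEmb W (eY i)))) := by
    rw [← Set.range_comp]; rfl
  rw [h, Submodule.span_image, span_range_intVec_adapted_reindex W hW eY]

include hW in
/-- **The complex span of the adapted frame is `cxSpan Φ W`** (`Φ(W)` is already complex).
[cite: Lange2023AbelianVarietiesComplex, §1.1.6 Exercise (2)(a) (p. 26)] -/
theorem frameSpan_adapted_reindex_eq_cxSpan (eY : Fin m ≃ Fin (subRank W)) :
    frameSpan Φ (fun i ↦ adaptedBasis W (adaptedEmb W (eY i))) = cxSpan Φ W := by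
  refine le_antisymm (Submodule.span_le.2 ?_) (Submodule.span_le.2 ?_)
  · rintro _ ⟨i, rfl⟩
    rw [latticeTuple_apply]
    exact apply_mem_cxSpan Φ W ((mem_subLattice_iff).1 (adaptedBasis_adaptedEmb_mem W (eY i)))
  · rintro _ ⟨w, hw, rfl⟩
    have h : Φ w ∈ Submodule.span ℝ (Set.range (latticeTuple Φ fun i ↦ adaptedBasis W (adaptedEmb W (eY i)))) := by
      rw [span_range_latticeTuple_adapted_reindex Φ W hW eY]
      exact ⟨w, hw, rfl⟩
    exact Submodule.span_subset_span ℝ ℂ _ h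

end Spans

/-! ### §2. `[Z_{λ′∘eY}] = sign_Y(eY) · p^*vol_{X/Y}` for every enumeration `eY` of the adapted frame -/

section Sign

variable {ι : Type*} [Fintype ι] [DecidableEq ι] {E : Type*} [NormedAddCommGroup E] [NormedSpace ℂ E]
  (Φ : (ι → ℝ) ≃L[ℝ] E) (W : Submodule ℝ (ι → ℝ)) (hW : IsLatticeSubspace W) (hWc : IsComplexSubspace Φ W)
  {m l : ℕ}

omit [Fintype ι] in
/-- `∫_X` of a top form reindexed along `Fin a = Fin b` (cf. `torusIntegral_domDomCongr_finCongr` of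
`ComplexTorusFourierInversion`). [cite: Lange2023AbelianVarietiesComplex, §6.2.4 (p. 310)] -/
private theorem torusIntegral_domDomCongr_finCongr_aux' {a b : ℕ} (h : a = b) (e : Fin b ≃ ι)
    (θ : E [⋀^Fin a]→L[ℝ] ℂ) :
    torusIntegral Φ e (θ.domDomCongr (finCongr h)) = torusIntegral Φ ((finCongr h).trans e) θ := by
  subst h
  rw [finCongr_refl, Equiv.refl_trans, ContinuousAlternatingMap.domDomCongr_refl]

/-- An integer scalar on a complex-valued form acts through the real scalars. [folklore] -/
private theorem intCast_smul_eq_realCast_smul'' {V : Type*} [NormedAddCommGroup V] [NormedSpace ℝ V] {k : ℕ}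
    (z : ℤ) (α : V [⋀^Fin k]→L[ℝ] ℂ) : (z : ℂ) • α = ((z : ℝ) : ℝ) • α := by
  ext v
  simp only [ContinuousAlternatingMap.smul_apply, smul_eq_mul, Complex.real_smul, Complex.ofReal_intCast]

omit [DecidableEq ι] in
include Φ hW hWc in
/-- An enumeration `eY : Fin m ≃ Fin (rk(Λ ∩ W))` forces `m = 2 dim_ℂ Y` to be even. [cite: Lange2023AbelianVarietiesComplex, §1.1.6 Exercise (2)(a) (p. 26)] -/
theorem even_of_equiv_subRank (eY : Fin m ≃ Fin (subRank W)) : Even m := by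
  have h := Fintype.card_congr eY
  simp only [Fintype.card_fin] at h
  have h2 := finrank_complex_mul_two (subtorusPeriod Φ W hW hWc) (Equiv.refl _)
  exact ⟨Module.finrank ℂ (cxSpan Φ W), by omega⟩

/-- **`∫_X η ∧ p^*vol_{X/Y} = sign_Y(eY) · η(Φ(λ′ ∘ eY))`** for every enumeration `eY` of the adapted frame and every
invariant `m`-form `η` (row A2's Fubini `torusIntegral_wedge_comp_quotientMapL` with graded commutativity, `m` even).
[cite: Lange2023AbelianVarietiesComplex, §2.2.1 Lemma 2.2.4 (proof, p0092) and §6.2.4 (p. 310)] [cite: Fulton1998, §1.7 (p0029 L11–L22)] -/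
theorem torusIntegral_wedge_pullback_volumeForm_reindex (e : Fin (m + l) ≃ ι) (eY : Fin m ≃ Fin (subRank W))
    (e'' : Fin l ≃ QuotIndex W) (η : E [⋀^Fin m]→L[ℝ] ℂ) :
    torusIntegral Φ e (η.wedge ((volumeForm (quotientTorusPeriod Φ W hW hWc) e'').compContinuousLinearMap
        (realRep Φ (quotientTorusPeriod Φ W hW hWc) (quotientTorusMatrix W)))) =
      orientationSign (subtorusPeriod Φ W hW hWc) eY *
        η (latticeTuple Φ fun i ↦ adaptedBasis W (adaptedEmb W (eY i))) := by
  set P := (volumeForm (quotientTorusPeriod Φ W hW hWc) e'').compContinuousLinearMap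
    (realRep Φ (quotientTorusPeriod Φ W hW hWc) (quotientTorusMatrix W)) with hP
  have hcomm := ContinuousAlternatingMap.WedgeComm_holds ℝ E ℂ P η
  have heven : ((-1 : ℝ) ^ (l * m)) = 1 :=
    Even.neg_one_pow ((even_of_equiv_subRank Φ W hW hWc eY).mul_left l)
  rw [heven, one_smul] at hcomm
  rw [hcomm, torusIntegral_domDomCongr_finCongr_aux', hP, realRep_quotientTorusMatrix,
    torusIntegral_wedge_comp_quotientMapL Φ W hW hWc _ e'' eY, torusIntegral_volumeForm, one_mul,
    torusIntegral, ContinuousAlternatingMap.compContinuousLinearMap_apply]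
  congr 2
  funext j
  rw [Function.comp_apply, ContinuousLinearMap.coe_restrictScalars', Submodule.subtypeL_apply,
    coe_latticeFrame_subtorusPeriod, latticeTuple_apply]
  rfl

/-- **`[Z_{λ′∘eY}] = sign_Y(eY) · p^*vol_{X/Y}`**: the class of the re-enumerated adapted frame is the pull-back of
the point class of `X/Y` times the orientation character of the enumeration for the complex structure of `Y`.
[cite: Fulton1998, §1.7 (p0029 L11–L22) and Cor. 19.2 (b) (p0365 L19–L34)] [cite: Lange2023AbelianVarietiesComplex, §2.5.3 Lemma 2.5.14 and §6.2.4 (p. 310)] [cite: VoisinHodgeI2002, §11.1.2 Cor. 11.15] -/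
theorem cycleFormOfFrame_adapted_reindex_eq_orientationSign_smul (e : Fin (m + l) ≃ ι)
    (eY : Fin m ≃ Fin (subRank W)) (e'' : Fin l ≃ QuotIndex W) :
    cycleFormOfFrame Φ e (fun i ↦ adaptedBasis W (adaptedEmb W (eY i))) =
      (orientationSign (subtorusPeriod Φ W hW hWc) eY : ℂ) •
        (volumeForm (quotientTorusPeriod Φ W hW hWc) e'').compContinuousLinearMap
          (realRep Φ (quotientTorusPeriod Φ W hW hWc) (quotientTorusMatrix W)) := by
  refine (eq_cycleFormOfFrame_of_forall Φ e _ fun η ↦ ?_).symm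
  rw [intCast_smul_eq_realCast_smul'', ContinuousAlternatingMap.wedge_smul_right, ← intCast_smul_eq_realCast_smul'',
    torusIntegral_smul, torusIntegral_wedge_pullback_volumeForm_reindex Φ W hW hWc e eY e'' η, ← mul_assoc,
    ← Int.cast_mul, orientationSign_mul_self, Int.cast_one, one_mul]

/-- **`[Z_{λ′∘eY}] = p^*vol_{X/Y}` on the nose for a positively oriented enumeration** (`sign_Y(eY) = 1`).
[cite: Fulton1998, §1.7 (p0029 L11–L22) and Cor. 19.2 (b) (p0365 L19–L34)] [cite: VoisinHodgeI2002, §11.1.2 Cor. 11.15] -/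
theorem cycleFormOfFrame_adapted_reindex_eq_pullback_volumeForm (e : Fin (m + l) ≃ ι)
    {eY : Fin m ≃ Fin (subRank W)} (hpos : orientationSign (subtorusPeriod Φ W hW hWc) eY = 1)
    (e'' : Fin l ≃ QuotIndex W) :
    cycleFormOfFrame Φ e (fun i ↦ adaptedBasis W (adaptedEmb W (eY i))) =
      (volumeForm (quotientTorusPeriod Φ W hW hWc) e'').compContinuousLinearMap
        (realRep Φ (quotientTorusPeriod Φ W hW hWc) (quotientTorusMatrix W)) := by
  rw [cycleFormOfFrame_adapted_reindex_eq_orientationSign_smul Φ W hW hWc e eY e'', hpos, Int.cast_one, one_smul]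

end Sign

/-! ### §3. The subtorus frame of a complex lattice subspace -/

section Frame

variable {ι : Type*} [Fintype ι] [DecidableEq ι] {E : Type*} [NormedAddCommGroup E] [NormedSpace ℂ E]
  (Φ : (ι → ℝ) ≃L[ℝ] E) (W : Submodule ℝ (ι → ℝ)) (hW : IsLatticeSubspace W) (hWc : IsComplexSubspace Φ W)
  {m l : ℕ}

omit [Fintype ι] in
/-- The orientation sign is insensitive to a cast `Fin a = Fin b` of the enumeration. [folklore] -/
private theorem orientationSign_comp_cast' {κ F : Type*} [NormedAddCommGroup F] [NormedSpace ℂ F] [DecidableEq κ]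
    (Ψ : (κ → ℝ) ≃L[ℝ] F) {a b : ℕ} (h : a = b) (f : Fin b → κ) :
    orientationSign Ψ (f ∘ Fin.cast h) = orientationSign Ψ f := by
  subst h; rfl

omit [DecidableEq ι] in
include hW hWc in
/-- `Y` is finite-dimensional over `ℂ` (its universal cover `cxSpan Φ W`). [cite: Lange2023AbelianVarietiesComplex, §1.1.6 Exercise (2)(a) (p. 26)] -/
theorem finiteDimensional_cxSpan : FiniteDimensional ℂ (cxSpan Φ W) := by
  haveI := finiteDimensional_real (subtorusPeriod Φ W hW hWc) (Equiv.refl _)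
  exact Module.Finite.of_restrictScalars_finite ℝ ℂ (cxSpan Φ W)

omit [DecidableEq ι] in
/-- **There is a positively oriented enumeration of the adapted basis of `Λ ∩ W`** (for the complex structure of
`Y`): either the chosen enumeration or a transposition of it (an orientation is one of the two components of
`Λ^{top} ∖ 0`; `rk(Λ ∩ W) = 0` is positively oriented vacuously). [cite: VoisinHodgeI2002, §11.1.2 Cor. 11.15] [cite: WarnerGTM94, Exercise 2.13] -/
theorem exists_orientationSign_subtorusPeriod_eq_one :
    ∃ eY : Fin (subRank W) ≃ Fin (subRank W), orientationSign (subtorusPeriod Φ W hW hWc) eY = 1 := by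
  classical
  set Ψ := subtorusPeriod Φ W hW hWc with hΨ
  haveI := finiteDimensional_cxSpan Φ W hW hWc
  have hq := finrank_complex_mul_two Ψ (Equiv.refl _)
  set q := Module.finrank ℂ (cxSpan Φ W) with hq_def
  let b : Module.Basis (Fin q) ℂ (cxSpan Φ W) := Module.finBasisOfFinrankEq ℂ (cxSpan Φ W) hq_def.symm
  by_cases h0 : subRank W = 0
  · -- the empty frame is positively oriented
    refine ⟨Equiv.refl _, (orientationSign_eq_one_iff _ _).2 ⟨q, hq, b, ?_⟩⟩
    haveI : IsEmpty (Fin (subRank W)) := by rw [h0]; infer_instance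
    rw [Module.Basis.det_apply, Matrix.det_isEmpty]
    exact one_pos
  · have h2 : 2 ≤ subRank W := by omega
    have h01 : (⟨0, by omega⟩ : Fin (subRank W)) ≠ ⟨1, by omega⟩ := by simp [Fin.ext_iff]
    rcases isPosOriented_or_comp_swap hq b (latticeBasis Ψ (Equiv.refl _)) h01 with hpos | hpos
    · exact ⟨Equiv.refl _, (orientationSign_eq_one_iff _ _).2 (by rwa [coe_latticeBasis] at hpos)⟩
    · refine ⟨Equiv.swap ⟨0, by omega⟩ ⟨1, by omega⟩, (orientationSign_eq_one_iff _ _).2 ?_⟩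
      rw [coe_latticeBasis] at hpos
      exact hpos

omit [DecidableEq ι] in
/-- … and one indexed by an explicitly even type `Fin (2d)`, `d = dim_ℂ Y`.
[cite: VoisinHodgeI2002, §11.1.2 Cor. 11.15] -/
theorem exists_orientationSign_subtorusPeriod_eq_one_two_mul :
    ∃ (d : ℕ) (eY : Fin (2 * d) ≃ Fin (subRank W)), orientationSign (subtorusPeriod Φ W hW hWc) eY = 1 := by
  obtain ⟨eY, heY⟩ := exists_orientationSign_subtorusPeriod_eq_one Φ W hW hWc
  obtain ⟨d, hd⟩ := even_of_equiv_subRank Φ W hW hWc (Equiv.refl (Fin (subRank W)))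
  refine ⟨d, (finCongr (by omega : 2 * d = subRank W)).trans eY, ?_⟩
  have h : ⇑((finCongr (by omega : 2 * d = subRank W)).trans eY) = ⇑eY ∘ Fin.cast (by omega : 2 * d = subRank W) := rfl
  rw [h, orientationSign_comp_cast']
  exact heY

/-- **The subtorus frame of a complex lattice subspace.** For a complex lattice subspace `W ⊆ Λ ⊗ ℝ` (`hW`, `hWc`:
the subtorus `Y = π(ΦW) ⊂ X`) and a positively oriented enumeration `eY` of the adapted basis `λ′` of `Λ ∩ W`
(`exists_orientationSign_subtorusPeriod_eq_one`), the datum `λ′ ∘ eY` is a `SubtorusFrame` in the sense of row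
A4-18: saturated (`Λ ∩ Σ ℝ Φλ′ᵢ = Σ ℤ λ′ᵢ`) and positively oriented for the complex structure of `Σ ℂ Φλ′ᵢ = ΦW` —
the bridge from the `W`-presentation of subtori (rows A1-19 / Q247: `subtorusPeriod`, `quotientTorusPeriod`) to the
frame presentation (row A4-18: `SubtorusFrame`, cycle classes `[Z]`).
[cite: LangeBirkenhake1992, Exercise 1.1.6 (2)(a)] [cite: Lange2023AbelianVarietiesComplex, §1.1.6 Exercise (2)(a) (p. 26)] -/
def SubtorusFrame.ofSubspace (eY : Fin m ≃ Fin (subRank W))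
    (hpos : orientationSign (subtorusPeriod Φ W hW hWc) eY = 1) : SubtorusFrame Φ m where
  frame i := adaptedBasis W (adaptedEmb W (eY i))
  saturated n hn := by
    rw [span_range_latticeTuple_adapted_reindex Φ W hW eY, Submodule.mem_map] at hn
    obtain ⟨w, hw, hwn⟩ := hn
    have hn' : n ∈ subLattice W := by
      rw [mem_subLattice_iff]
      have : intVec n = w := Φ.injective (hwn.trans rfl).symm
      rwa [this]
    rw [← span_range_adaptedBasis_eq_subLattice] at hn'
    have hr : (Set.range fun i ↦ adaptedBasis W (adaptedEmb W (eY i))) =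
        Set.range fun i ↦ adaptedBasis W (adaptedEmb W i) := by
      ext x
      simp only [Set.mem_range]
      exact ⟨fun ⟨i, hi⟩ ↦ ⟨eY i, hi⟩, fun ⟨j, hj⟩ ↦ ⟨eY.symm j, by rwa [Equiv.apply_symm_apply]⟩⟩
    rwa [hr]
  posOriented := by
    have hK := frameSpan_adapted_reindex_eq_cxSpan Φ W hW eY
    let φ : frameSpan Φ (fun i ↦ adaptedBasis W (adaptedEmb W (eY i))) ≃ₗ[ℂ] cxSpan Φ W := LinearEquiv.ofEq _ _ hK
    rw [← isPosOriented_comp_linearEquiv_iff φ]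
    have hφ : ⇑φ ∘ frameInSpan Φ (fun i ↦ adaptedBasis W (adaptedEmb W (eY i))) =
        latticeFrame (subtorusPeriod Φ W hW hWc) eY := by
      funext i
      apply Subtype.ext
      rw [Function.comp_apply, coe_latticeFrame_subtorusPeriod Φ W hW hWc eY i]
      rfl
    rw [hφ]
    exact (orientationSign_eq_one_iff _ _).1 hpos

omit [DecidableEq ι] in
/-- The frame of `ofSubspace` is the re-enumerated adapted basis. [cite: Lange2023AbelianVarietiesComplex, §1.1.6 Exercise (2)(a) (p. 26)] -/
@[simp] theorem SubtorusFrame.ofSubspace_frame (eY : Fin m ≃ Fin (subRank W))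
    (hpos : orientationSign (subtorusPeriod Φ W hW hWc) eY = 1) :
    (SubtorusFrame.ofSubspace Φ W hW hWc eY hpos).frame = fun i ↦ adaptedBasis W (adaptedEmb W (eY i)) := rfl

omit [DecidableEq ι] in
/-- **Its real span is `Φ(W)`.** [cite: Lange2023AbelianVarietiesComplex, §1.1.6 Exercise (2)(a) (p. 26)] -/
theorem SubtorusFrame.realSpan_ofSubspace (eY : Fin m ≃ Fin (subRank W))
    (hpos : orientationSign (subtorusPeriod Φ W hW hWc) eY = 1) :
    (SubtorusFrame.ofSubspace Φ W hW hWc eY hpos).realSpan = W.map (Φ : (ι → ℝ) →ₗ[ℝ] E) :=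
  span_range_latticeTuple_adapted_reindex Φ W hW eY

omit [DecidableEq ι] in
/-- **Its subtorus is `Y = π(ΦW)`**: the carrier through `0` is `proj Φ '' W` (= the range of `ι_Y`,
`range_subtorusMap`, = the kernel of `p`, `ker_quotientTorusMap`). [cite: Lange2023AbelianVarietiesComplex, §1.1.6 Exercise (2)(a) (p. 26)] -/
theorem SubtorusFrame.carrier_ofSubspace_zero (eY : Fin m ≃ Fin (subRank W))
    (hpos : orientationSign (subtorusPeriod Φ W hW hWc) eY = 1) :
    (SubtorusFrame.ofSubspace Φ W hW hWc eY hpos).carrier 0 = proj Φ '' (W : Set (ι → ℝ)) := by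
  rw [SubtorusFrame.carrier, SubtorusFrame.realSpan_ofSubspace]
  ext t
  simp only [Set.mem_image, Submodule.map_coe, zero_add, SetLike.mem_coe]
  constructor
  · rintro ⟨_, ⟨w, hw, rfl⟩, rfl⟩
    exact ⟨w, hw, by rw [cover]; simp⟩
  · rintro ⟨w, hw, rfl⟩
    exact ⟨Φ w, ⟨w, hw, rfl⟩, by rw [cover]; simp⟩

omit [DecidableEq ι] in
/-- The carrier is the range of the embedding `ι_Y : Y ↪ X`. [cite: Lange2023AbelianVarietiesComplex, §1.1.6 Exercise (2)(a) (p. 26)] -/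
theorem SubtorusFrame.carrier_ofSubspace_zero_eq_range (eY : Fin m ≃ Fin (subRank W))
    (hpos : orientationSign (subtorusPeriod Φ W hW hWc) eY = 1) :
    (SubtorusFrame.ofSubspace Φ W hW hWc eY hpos).carrier 0 =
      Set.range (mapMatrix (subtorusPeriod Φ W hW hWc) Φ (subtorusMatrix W)) := by
  rw [SubtorusFrame.carrier_ofSubspace_zero, range_subtorusMap]

omit [DecidableEq ι] in
/-- The carrier is the fibre `p⁻¹(0)` of the projection `p : X → X/Y`. [cite: Fulton1998, §1.7 (p0029 L11–L22)] [cite: Lange2023AbelianVarietiesComplex, §1.5.4 (p. 58)] -/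
theorem SubtorusFrame.carrier_ofSubspace_zero_eq_ker (eY : Fin m ≃ Fin (subRank W))
    (hpos : orientationSign (subtorusPeriod Φ W hW hWc) eY = 1) :
    (SubtorusFrame.ofSubspace Φ W hW hWc eY hpos).carrier 0 =
      ((mapMatrixHom Φ (quotientTorusPeriod Φ W hW hWc) (quotientTorusMatrix W)).ker : Set (ComplexTorus Φ)) := by
  rw [SubtorusFrame.carrier_ofSubspace_zero, ker_quotientTorusMap]

/-- **The cycle class of the frame is the pull-back of the point class of `X/Y`**: `[Z] = p^*vol_{X/Y}` for the
positively oriented frame `λ′ ∘ eY` — `[Y] = [p⁻¹(0)] = p^*[0]` with complex orientations throughout.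
[cite: Fulton1998, §1.7 (p0029 L11–L22) and Cor. 19.2 (b) (p0365 L19–L34)] [cite: VoisinHodgeI2002, §11.1.2 Cor. 11.15] -/
theorem SubtorusFrame.cycleForm_ofSubspace (eY : Fin m ≃ Fin (subRank W))
    (hpos : orientationSign (subtorusPeriod Φ W hW hWc) eY = 1) (e : Fin (m + l) ≃ ι) (e'' : Fin l ≃ QuotIndex W) :
    (SubtorusFrame.ofSubspace Φ W hW hWc eY hpos).cycleForm e =
      (volumeForm (quotientTorusPeriod Φ W hW hWc) e'').compContinuousLinearMap
        (realRep Φ (quotientTorusPeriod Φ W hW hWc) (quotientTorusMatrix W)) :=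
  cycleFormOfFrame_adapted_reindex_eq_pullback_volumeForm Φ W hW hWc e hpos e''

end Frame

/-! ### §4. The analytic cycle class of the subtorus: `cl(Y) = sign(e) · p^*vol_{X/Y}` -/

section Analytic

universe u

variable {ι : Type*} [Fintype ι] [DecidableEq ι] {E : Type u} [NormedAddCommGroup E] [InnerProductSpace ℂ E]
  [FiniteDimensional ℂ E] [MeasurableSpace E] [BorelSpace E]
  (Φ : (ι → ℝ) ≃L[ℝ] E) (W : Submodule ℝ (ι → ℝ)) (hW : IsLatticeSubspace W) (hWc : IsComplexSubspace Φ W)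
  {d l n : ℕ}

/-- **`cl(Y) = sign(e) · p^*vol_{X/Y}` for the ANALYTIC cycle class** (row A4-18 stage (ii): the Poincaré dual form
of the current of integration over the closed analytic subvariety `Y = π(ΦW) ⊂ X`, computed by
`SubtorusFrame.analyticCycleClass_carrier_eq_smul_cycleForm`): the class of the subtorus is the pull-back of the
point class `vol_{X/Y}` of the quotient, up to the normalisation `sign(e)` of the tree's `analyticCycleClass`.
[cite: Fulton1998, §1.7 (p0029 L11–L22) and Cor. 19.2 (b) (p0365 L19–L34)] [cite: VoisinHodgeI2002, §11.1.2 Cor. 11.15] -/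
theorem SubtorusFrame.analyticCycleClass_ofSubspace_carrier (eY : Fin (2 * d) ≃ Fin (subRank W))
    (hpos : orientationSign (subtorusPeriod Φ W hW hWc) eY = 1) (e : Fin n ≃ ι) (h : 2 * d + l = n)
    (e'' : Fin l ≃ QuotIndex W) :
    analyticCycleClass Φ e h ((SubtorusFrame.ofSubspace Φ W hW hWc eY hpos).hasPureDim_carrier 0) =
      (orientationSign Φ ((finCongr h).trans e) : ℂ) •
        (volumeForm (quotientTorusPeriod Φ W hW hWc) e'').compContinuousLinearMap
          (realRep Φ (quotientTorusPeriod Φ W hW hWc) (quotientTorusMatrix W)) := by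
  rw [SubtorusFrame.analyticCycleClass_carrier_eq_smul_cycleForm,
    SubtorusFrame.cycleForm_ofSubspace Φ W hW hWc eY hpos _ e'']

/-- **`cl(Y) = p^*[pt_{X/Y}]` on the nose** for a positively oriented enumeration `e` of the lattice basis of `X`
(the convention `orientationSign Φ e = 1` of rows A4-18 / Q58). [cite: Fulton1998, §1.7 (p0029 L11–L22) and Cor. 19.2 (b) (p0365 L19–L34)] [cite: VoisinHodgeI2002, §11.1.2 Cor. 11.15] -/
theorem SubtorusFrame.analyticCycleClass_ofSubspace_carrier_of_orientationSign_eq_one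
    (eY : Fin (2 * d) ≃ Fin (subRank W)) (hpos : orientationSign (subtorusPeriod Φ W hW hWc) eY = 1)
    (e : Fin n ≃ ι) (h : 2 * d + l = n) (he : orientationSign Φ ((finCongr h).trans e) = 1)
    (e'' : Fin l ≃ QuotIndex W) :
    analyticCycleClass Φ e h ((SubtorusFrame.ofSubspace Φ W hW hWc eY hpos).hasPureDim_carrier 0) =
      (volumeForm (quotientTorusPeriod Φ W hW hWc) e'').compContinuousLinearMap
        (realRep Φ (quotientTorusPeriod Φ W hW hWc) (quotientTorusMatrix W)) := by
  rw [SubtorusFrame.analyticCycleClass_ofSubspace_carrier Φ W hW hWc eY hpos e h e'', he, Int.cast_one, one_smul]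

end Analytic

end ComplexTorus

end Literature.Geometry.Kaehler
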